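import Literature.Computability.Cryptography.HallgrenClassGroupFormGroup
import Literature.NumberTheory.QuadraticFields.IdealsOfPrimePowerNormCases
import HarnessLib

/-!
# Hallgren 2005 / class groups — enumerating the ideals of a given norm by reduced forms, I:
# the local data at a prime

Topic `Literature/Computability/Cryptography`; companion of `HallgrenClassGroupFormGroup.lean`
(`classOf`, `compose`, `formPow`) and `IdealsOfPrimePowerNormCases.lean` (ideals of norm `p^e`).

The unconditional torsion-witness sampler for `3 ∣ h(−d)` needs, for a norm `a` with known
factorisation, an explicit list of reduced forms whose classes are exactly the classes of the
ideals of norm `a`, with multiplicity (Cohen, *A Course in Computational Algebraic Number Theory*,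
§5.2; Cox §7.B). This file supplies the data at one prime `p` of `d_K = D`:

* `primeRoot D p` — the least `β < 2p` with `β² ≡ D (mod 4p)` (if any), `primeForm D p β` — the
  prime form `(p, β, (β² − D)/4p)` (its form ideal is the prime `𝔭 = (p, ω − k)` over `p`,
  `k = (β + D)/2`; the opposite form `(p, −β, ·)` gives the conjugate `𝔭'`);
* `localCount D p e` — the number of ideals of norm `p^e`: `e + 1` (split, `p ∤ β`), `1`
  (ramified, `p ∣ β`), `1`/`0` (inert: no `β`; `e` even/odd); `localForm D p e j` — the reduced
  form `f^j ∘ f'^{e−j}` (resp. the principal form) of the `j`-th of them;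
* `localIdeal` and the local dictionary: `absNorm_localIdeal`, `localIdeal_injective`,
  `exists_eq_localIdeal`, `mk0_localIdeal` (`[localIdeal j] = classOf (localForm j)`).

The product over the primes of `a` is taken in `HallgrenClassGroupIdealEnumerationProduct.lean`.

## References

* H. Cohen, *A Course in Computational Algebraic Number Theory*, GTM 138 (1993), §5.2 [Cohen1993].
* D. A. Cox, *Primes of the form x² + ny²*, 2nd ed. (2013), §5.B Prop. 5.16, §7.B Thm. 7.7 [Cox2013].
* S. Hallgren, *Fast quantum algorithms for computing the unit group and class group of a number
  field*, STOC 2005, §4 [Hallgren2005].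
-/

noncomputable section

open scoped nonZeroDivisors

namespace Literature.Computability.Cryptography.Hallgren2005

namespace FormComposition

open Module NumberField Ideal
open Literature.NumberTheory.QuadraticFields.Quadratic Literature.NumberTheory.QuadraticFields.Quadratic.BinQF
open Literature.NumberTheory.EllipticCurves Composition Reduction

/-! ### Field-free enumeration data at a prime -/

/-- The least `β ∈ [0, 2p)` with `β² ≡ D (mod 4p)`, if any (the middle coefficient of the prime
form above `p`). [cite: Cohen1993, §5.2] -/
def primeRoot (D : ℤ) (p : ℕ) : Option ℕ :=
  (List.range (2 * p)).find? fun β => decide ((4 * (p : ℤ)) ∣ (β : ℤ) ^ 2 - D)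

/-- The prime form `(p, β, (β² − D)/4p)` of discriminant `D`. [cite: Cox2013, §7.B] -/
def primeForm (D : ℤ) (p : ℕ) (β : ℤ) : BinQF := ⟨p, β, (β ^ 2 - D) / (4 * p)⟩

/-- The number of ideals of norm `p^e`: `e + 1` if `p` splits, `1` if `p` ramifies, and `1` or `0`
(as `e` is even or odd) if `p` is inert. [cite: Cohen1993, §5.2] -/
def localCount (D : ℤ) (p e : ℕ) : ℕ :=
  match primeRoot D p with
  | none => if 2 ∣ e then 1 else 0
  | some β => if (p : ℤ) ∣ (β : ℤ) then 1 else e + 1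

/-- The reduced form of the `j`-th ideal of norm `p^e`: `f^j ∘ f'^{e−j}` for the prime form `f`
and its opposite `f'` (the principal form if `p` is inert). [cite: Cohen1993, §5.2] -/
def localForm (D : ℤ) (p e j : ℕ) : BinQF :=
  match primeRoot D p with
  | none => one D
  | some β => compose D (formPow D (primeForm D p β) j)
      (formPow D (primeForm D p (-(β : ℤ))) (e - j))

/-- `primeRoot D p = some β`: `β < 2p`, `4p ∣ β² − D`, and `β` is least. [folklore] -/
theorem primeRoot_eq_some_iff {D : ℤ} {p β : ℕ} :
    primeRoot D p = some β ↔ β < 2 * p ∧ (4 * (p : ℤ)) ∣ (β : ℤ) ^ 2 - D ∧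
      ∀ γ : ℕ, γ < β → ¬ (4 * (p : ℤ)) ∣ (γ : ℤ) ^ 2 - D := by
  rw [primeRoot, List.find?_range_eq_some]
  simp only [decide_eq_true_eq, List.mem_range, Bool.not_eq_eq_eq_not, Bool.not_true,
    decide_eq_false_iff_not]
  tauto

/-- `primeRoot D p = none`: no `β < 2p` has `4p ∣ β² − D`. [folklore] -/
theorem primeRoot_eq_none_iff {D : ℤ} {p : ℕ} :
    primeRoot D p = none ↔ ∀ β : ℕ, β < 2 * p → ¬ (4 * (p : ℤ)) ∣ (β : ℤ) ^ 2 - D := by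
  rw [primeRoot, List.find?_range_eq_none]
  simp

/-- If some integer `B` has `4p ∣ B² − D` then `primeRoot D p ≠ none` (reduce `B` mod `2p`).
[folklore] -/
theorem primeRoot_ne_none_of_dvd {D : ℤ} {p : ℕ} (hp : p ≠ 0) {B : ℤ}
    (hB : (4 * (p : ℤ)) ∣ B ^ 2 - D) : primeRoot D p ≠ none := by
  intro h
  rw [primeRoot_eq_none_iff] at h
  have h2p : (0 : ℤ) < 2 * p := by positivity
  refine h (B % (2 * p)).toNat (by
    have := Int.emod_lt_of_pos B h2p
    have h0 := Int.emod_nonneg B h2p.ne'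
    omega) ?_
  rw [Int.toNat_of_nonneg (Int.emod_nonneg B h2p.ne')]
  have hdiv : B % (2 * p) = B - 2 * p * (B / (2 * p)) := by
    rw [Int.emod_def]
  rw [hdiv]
  obtain ⟨c, hc⟩ := hB
  exact ⟨c - B * (B / (2 * p)) + p * (B / (2 * p)) ^ 2, by linear_combination hc⟩

/-- The prime form has discriminant `D` (when `4p ∣ β² − D`, `p ≠ 0`). [folklore] -/
theorem disc_primeForm {D : ℤ} {p : ℕ} (hp : p ≠ 0) {β : ℤ} (hβ : (4 * (p : ℤ)) ∣ β ^ 2 - D) :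
    (primeForm D p β).disc = D := by
  obtain ⟨c, hc⟩ := hβ
  have h4p : (4 * (p : ℤ)) ≠ 0 := by positivity
  simp only [primeForm, BinQF.disc]
  rw [hc, Int.mul_ediv_cancel_left _ h4p]
  linear_combination hc

/-- `4p ∣ (−β)² − D` as well. [folklore] -/
theorem dvd_neg_sq_sub {D : ℤ} {p : ℕ} {β : ℤ} (hβ : (4 * (p : ℤ)) ∣ β ^ 2 - D) :
    (4 * (p : ℤ)) ∣ (-β) ^ 2 - D := by rwa [neg_sq]

/-- `k(f') = D − k(f)` for the opposite prime form `f' = (p, −β, ·)` of `f = (p, β, ·)`. [folklore] -/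
theorem kOf_primeForm_neg {D : ℤ} {p : ℕ} {β : ℤ} (hβ : (4 * (p : ℤ)) ∣ β ^ 2 - D) :
    kOf D (primeForm D p (-β)) = D - kOf D (primeForm D p β) := by
  have h2 : (2 : ℤ) ∣ β + D := by
    obtain ⟨c, hc⟩ := hβ
    obtain ⟨r, hr⟩ := Int.even_mul_succ_self β
    exact ⟨r - 2 * p * c, by linear_combination -hc + hr⟩
  obtain ⟨s, hs⟩ := h2
  simp only [kOf, primeForm]
  rw [show -β + D = 2 * (D - s) by linarith, show β + D = 2 * s by linarith,
    Int.mul_ediv_cancel_left _ two_ne_zero, Int.mul_ediv_cancel_left _ two_ne_zero]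

/-! ### The local dictionary in an imaginary quadratic field -/

section Ring

variable {K : Type*} [Field K] [NumberField K] (b : Basis (Fin 2) ℤ (𝓞 K)) (hb : b 0 = 1)
  (hω : b 1 * b 1 = (mOf (NumberField.discr K) : 𝓞 K) + (NumberField.discr K : 𝓞 K) * b 1)

include hb hω in
/-- **The prime form is a primitive positive definite form of discriminant `d_K`** (forms of the
fundamental discriminant `d_K` are primitive). [cite: Cox2013, §7.B] -/
theorem isPosPrim_primeForm (hK : IsImaginaryQuadratic K) {p : ℕ} (hp : p.Prime) {β : ℤ}
    (hβ : (4 * (p : ℤ)) ∣ β ^ 2 - NumberField.discr K) :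
    (primeForm (NumberField.discr K) p β).IsPosPrim (NumberField.discr K) := by
  set D := NumberField.discr K
  have hdisc := disc_primeForm hp.ne_zero hβ
  refine ⟨hdisc, by show (0 : ℤ) < p; exact_mod_cast hp.pos, ?_⟩
  rw [BinQF.isPrimitive_iff]
  intro e heA heB heC
  have hD4 : D % 4 = 0 ∨ D % 4 = 1 := discr_emod_four hK.finrank_eq_two
  have hdisc' : (primeForm D p β).b ^ 2 - 4 * (primeForm D p β).a * (primeForm D p β).c =
      D ^ 2 + 4 * mOf D := by
    rw [sq_add_four_mul_mOf hD4]; exact hdisc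
  exact isUnit_of_dvd_of_disc_eq b hb hω hdisc' heA heB heC

/-- The `j`-th ideal of norm `p^e`: `𝔭^j 𝔭'^{e−j}` (`𝔭`, `𝔭'` the form ideals of the prime form
and its opposite), or `(p)^{e/2}` if `p` is inert. [cite: Cohen1993, §5.2] -/
def localIdeal (p e j : ℕ) : Ideal (𝓞 K) :=
  match primeRoot (NumberField.discr K) p with
  | none => span {(p : 𝓞 K)} ^ (e / 2)
  | some β => formIdeal b (primeForm (NumberField.discr K) p β) ^ j *
      formIdeal b (primeForm (NumberField.discr K) p (-(β : ℤ))) ^ (e - j)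

/-- The data of file `IdealsOfPrimePowerNorm` for the prime form: with `k = k(f)`, `C = f.c`,
`pC = k² − d_K k − m(d_K)`, `2k − d_K = β`, `𝔭 = (p, ω − k)`, `𝔭' = (p, ω − (d_K − k))`. [folklore] -/
theorem primeForm_data (hK : IsImaginaryQuadratic K) {p : ℕ} (hp : p.Prime) {β : ℤ}
    (hβ : (4 * (p : ℤ)) ∣ β ^ 2 - NumberField.discr K) :
    (p : ℤ) * (primeForm (NumberField.discr K) p β).c =
        kOf (NumberField.discr K) (primeForm (NumberField.discr K) p β) ^ 2 -
          NumberField.discr K * kOf (NumberField.discr K) (primeForm (NumberField.discr K) p β) -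
            mOf (NumberField.discr K) ∧
      2 * kOf (NumberField.discr K) (primeForm (NumberField.discr K) p β) - NumberField.discr K = β ∧
      formIdeal b (primeForm (NumberField.discr K) p β) =
        span {((p : ℤ) : 𝓞 K), b 1 - (kOf (NumberField.discr K) (primeForm (NumberField.discr K) p β) : 𝓞 K)} ∧
      formIdeal b (primeForm (NumberField.discr K) p (-β)) =
        span {((p : ℤ) : 𝓞 K), b 1 - ((NumberField.discr K -
          kOf (NumberField.discr K) (primeForm (NumberField.discr K) p β) : ℤ) : 𝓞 K)} := by
  set D := NumberField.discr K
  have hdisc := disc_primeForm hp.ne_zero hβ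
  have hD4 : D % 4 = 0 ∨ D % 4 = 1 := discr_emod_four hK.finrank_eq_two
  refine ⟨norm_eq hdisc hD4, by rw [two_mul_kOf hdisc]; simp [primeForm], rfl, ?_⟩
  rw [formIdeal, kOf_primeForm_neg hβ]
  rfl

include hb hω in
/-- **Norm**: `N(localIdeal j) = p^e` for `j < localCount`. [cite: Cohen1993, §5.2] -/
theorem absNorm_localIdeal (hK : IsImaginaryQuadratic K) {p : ℕ} (hp : p.Prime) {e j : ℕ}
    (hj : j < localCount (NumberField.discr K) p e) :
    absNorm (localIdeal b p e j) = p ^ e := by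
  rcases hr : primeRoot (NumberField.discr K) p with _ | β
  · simp only [localIdeal, localCount, hr] at hj ⊢
    split_ifs at hj with h2
    · rw [absNorm_span_singleton_natCast_pow b, Nat.mul_div_cancel' h2]
    · omega
  · simp only [localIdeal, localCount, hr] at hj ⊢
    obtain ⟨-, hβ, -⟩ := primeRoot_eq_some_iff.1 hr
    obtain ⟨hn, -, h𝔭, h𝔭'⟩ := primeForm_data b hK hp hβ
    have hje : j ≤ e := by split_ifs at hj <;> omega
    rw [h𝔭, h𝔭', absNorm_pow_mul_pow b hb hω hn, Nat.add_sub_cancel' hje]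

include hb hω in
/-- **Distinctness**: `localIdeal j = localIdeal j'` with `j, j' < localCount` forces `j = j'`
(only the split case has more than one index; there `𝔭 ≠ 𝔭'`). [cite: Cohen1993, §5.2] -/
theorem localIdeal_injective (hK : IsImaginaryQuadratic K) {p : ℕ} (hp : p.Prime) {e j j' : ℕ}
    (hj : j < localCount (NumberField.discr K) p e) (hj' : j' < localCount (NumberField.discr K) p e)
    (h : localIdeal b p e j = localIdeal b p e j') : j = j' := by
  rcases hr : primeRoot (NumberField.discr K) p with _ | β
  · simp only [localCount, hr] at hj hj'
    split_ifs at hj hj' <;> omega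
  · simp only [localIdeal, localCount, hr] at hj hj' h
    obtain ⟨-, hβ, -⟩ := primeRoot_eq_some_iff.1 hr
    obtain ⟨hn, h2k, h𝔭, h𝔭'⟩ := primeForm_data b hK hp hβ
    split_ifs at hj hj' with hram
    · omega
    · rw [h𝔭, h𝔭'] at h
      exact eq_of_pow_mul_pow_eq b hb hω hp hn (by rwa [h2k]) h

include hb hω in
/-- **Exhaustion**: every ideal of norm `p^e` is `localIdeal j` for some `j < localCount`.
[cite: Cohen1993, §5.2] -/
theorem exists_eq_localIdeal (hK : IsImaginaryQuadratic K) {p : ℕ} (hp : p.Prime) {e : ℕ}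
    {I : Ideal (𝓞 K)} (hI : absNorm I = p ^ e) :
    ∃ j, j < localCount (NumberField.discr K) p e ∧ I = localIdeal b p e j := by
  have hD4 : NumberField.discr K % 4 = 0 ∨ NumberField.discr K % 4 = 1 :=
    discr_emod_four hK.finrank_eq_two
  rcases hr : primeRoot (NumberField.discr K) p with _ | β
  · simp only [localIdeal, localCount, hr]
    -- inert: no `k, C` with `pC = k² − Dk − m`
    have hinert : ∀ k C : ℤ, (p : ℤ) * C ≠
        k ^ 2 - NumberField.discr K * k - mOf (NumberField.discr K) := by
      intro k C hkC
      refine primeRoot_ne_none_of_dvd hp.ne_zero (B := 2 * k - NumberField.discr K) ?_ hr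
      have := sq_add_four_mul_mOf hD4
      exact ⟨C, by linear_combination (-4 : ℤ) * hkC + this⟩
    obtain ⟨h2, hIeq⟩ := even_and_eq_span_pow_of_absNorm_eq b hb hω hp hinert hI
    exact ⟨0, by rw [if_pos h2]; exact one_pos, hIeq⟩
  · simp only [localIdeal, localCount, hr]
    obtain ⟨-, hβ, -⟩ := primeRoot_eq_some_iff.1 hr
    obtain ⟨hn, h2k, h𝔭, h𝔭'⟩ := primeForm_data b hK hp hβ
    have hprim : ∀ d : ℤ, d ∣ (p : ℤ) → d ∣ 2 * kOf (NumberField.discr K)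
        (primeForm (NumberField.discr K) p β) - NumberField.discr K →
        d ∣ (primeForm (NumberField.discr K) p β).c → IsUnit d := by
      intro d hdA hdB hdC
      have hpp := isPosPrim_primeForm b hb hω hK hp hβ
      rw [h2k] at hdB
      exact (BinQF.isPrimitive_iff _).1 hpp.primitive d hdA hdB hdC
    split_ifs with hram
    · refine ⟨0, one_pos, ?_⟩
      have hram' : (p : ℤ) ∣ 2 * kOf (NumberField.discr K)
          (primeForm (NumberField.discr K) p β) - NumberField.discr K := by rwa [h2k]
      rw [h𝔭, h𝔭', pow_zero, one_mul, Nat.sub_zero, span_pair_conj_eq_of_dvd b hram']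
      exact eq_pow_of_absNorm_eq_of_dvd b hb hω hp hn hprim hram' hI
    · have hsplit : ¬ (p : ℤ) ∣ 2 * kOf (NumberField.discr K)
          (primeForm (NumberField.discr K) p β) - NumberField.discr K := by rwa [h2k]
      obtain ⟨i, j, hij, hIeq⟩ := exists_eq_pow_mul_pow_of_absNorm_eq b hb hω hp hn hprim hI
      refine ⟨i, by omega, ?_⟩
      rw [h𝔭, h𝔭', hIeq, show e - i = j by omega]

include hb in
/-- `localIdeal j` is a non-zero ideal. [folklore] -/
theorem localIdeal_mem_nonZeroDivisors {p : ℕ} (hp : p.Prime) (e j : ℕ) :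
    localIdeal b p e j ∈ (Ideal (𝓞 K))⁰ := by
  rcases hr : primeRoot (NumberField.discr K) p with _ | β
  · simp only [localIdeal, hr]
    refine pow_mem ?_ _
    rw [mem_nonZeroDivisors_iff_ne_zero, Ne, zero_eq_bot, span_singleton_eq_bot]
    exact_mod_cast hp.ne_zero
  · simp only [localIdeal, hr]
    have ha : 0 < (primeForm (NumberField.discr K) p β).a := by
      show (0 : ℤ) < p; exact_mod_cast hp.pos
    have ha' : 0 < (primeForm (NumberField.discr K) p (-(β : ℤ))).a := by
      show (0 : ℤ) < p; exact_mod_cast hp.pos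
    exact mul_mem (pow_mem (formIdeal_mem_nonZeroDivisors b hb ha) _)
      (pow_mem (formIdeal_mem_nonZeroDivisors b hb ha') _)

include hω in
/-- **Classes**: `[localIdeal j] = classOf (localForm j)`, and `localForm j` is a reduced primitive
positive definite form of discriminant `d_K` (for all `j`). [cite: Cox2013, §7.B Thm. 7.7] -/
theorem mk0_localIdeal (hK : IsImaginaryQuadratic K) {p : ℕ} (hp : p.Prime) (e j : ℕ) :
    (localForm (NumberField.discr K) p e j).IsPosPrim (NumberField.discr K) ∧
      (localForm (NumberField.discr K) p e j).IsReduced ∧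
      ClassGroup.mk0 ⟨localIdeal b p e j, localIdeal_mem_nonZeroDivisors b hb hp e j⟩ =
        classOf b hb (localForm (NumberField.discr K) p e j) := by
  have hD4 : NumberField.discr K % 4 = 0 ∨ NumberField.discr K % 4 = 1 :=
    discr_emod_four hK.finrank_eq_two
  rcases hr : primeRoot (NumberField.discr K) p with _ | β
  · have hloc : localIdeal b p e j = span {(p : 𝓞 K)} ^ (e / 2) := by simp only [localIdeal, hr]
    simp only [localForm, hr]
    obtain ⟨h1, h2⟩ := isPosPrim_one hK.discr_neg hD4
    refine ⟨h1, h2, ?_⟩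
    rw [classOf_one' b hb, ClassGroup.mk0_eq_one_iff]
    show Submodule.IsPrincipal (localIdeal b p e j)
    rw [hloc, span_singleton_pow]
    exact ⟨⟨(p : 𝓞 K) ^ (e / 2), rfl⟩⟩
  · have hloc : localIdeal b p e j = formIdeal b (primeForm (NumberField.discr K) p β) ^ j *
        formIdeal b (primeForm (NumberField.discr K) p (-(β : ℤ))) ^ (e - j) := by
      simp only [localIdeal, hr]
    simp only [localForm, hr]
    obtain ⟨-, hβ, -⟩ := primeRoot_eq_some_iff.1 hr
    have hf := isPosPrim_primeForm b hb hω hK hp hβ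
    have hf' := isPosPrim_primeForm b hb hω hK hp (dvd_neg_sq_sub hβ)
    obtain ⟨hpj, -, hcj⟩ := formPow_spec b hb hω hK hf j
    obtain ⟨hpj', -, hcj'⟩ := formPow_spec b hb hω hK hf' (e - j)
    refine ⟨isPosPrim_compose b hb hω hK hpj hpj', isReduced_compose b hb hω hK hpj hpj', ?_⟩
    rw [classOf_compose b hb hω hK hpj hpj', hcj, hcj', classOf_eq b hb hf.a_pos,
      classOf_eq b hb hf'.a_pos, ← map_pow, ← map_pow, ← map_mul]
    congr 1
    apply Subtype.ext
    simp only [Submonoid.coe_mul, SubmonoidClass.coe_pow]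
    exact hloc

end Ring

end FormComposition

end Literature.Computability.Cryptography.Hallgren2005

end
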